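import Summits.AtomisticToContinuum.BoseEinsteinCondensation.Theorems.BECInsertionCorrectorCorrectorClosureFlatDomination
import Literature.MathematicalPhysics.QuantumManyBody.PeriodicFeynmanKacEnergyLower
import HarnessLib

/-!
# The fidelity limit of the flat insertion partition function (line `residue-area-law`, stub 4)

Crux `BECInsertionCorrector.CorrectorClosure` (item stmt-AtomisticToContinuum-12058), line
`residue-area-law`, stub `stub_fidelityLimit`.

Fix `N`, a box `L > 0` and a measurable pair potential `v ≥ 0`. Let `Θ₀ : Config N → ℝ` be the
`N`-body torus Feynman–Kac ground state (`IsPeriodicGroundStateFK v L Θ₀`, continuous) and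
`Φ₀ : Config (N + 1) → ℝ` the `(N+1)`-body one (continuous and strictly positive). Add one particle
FLAT, `ψ₀ = g := ofReal ∘ Θ₀ ∘ vecTail` on `Config (N + 1)`, and let
`Z t = ∫⁻_{cellN (N+1) L} g · e^{-tH_{N+1}} g` (read through `periodicFKSemigroup v L t`). With
`E = E₀(N+1)` and the overlap `c = ∫⁻_{cellN (N+1) L} ofReal Φ₀ · g`:

* the ground-state projection field `IsPeriodicGroundStateFK.tendsto` of `Φ₀`, tested on the
  periodic square-integrable datum `g`, gives `e^{Et}(e^{-tH}g)(X) → c Φ₀(X)` for every `X`;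
* `Θ₀` is bounded (`exists_bound_of_continuous_periodic`) and `Φ₀ ≥ m > 0` (minimum over the compact
  closed cell, moved everywhere by periodicity), so `g ≤ (M/m) ofReal Φ₀` and, by monotonicity and
  linearity of the functional and the eigen-relation of `Φ₀`,
  `e^{Et}(e^{-tH}g) ≤ (M/m) Φ₀ ≤ (M/m) M'`: a constant majorant on the finite-measure cell;
* dominated convergence: `e^{Et} Z(t) → c²` and `e^{2Et} Z(2t) → c²`, with `0 < c < ∞`;
* `Z(0) = L³` (`stub_flatDomination`) and `c = ofReal (∫ Θ₀ ∫_cell Φ₀(x, ·))` (Tonelli, tagged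
  coordinate innermost, Bochner = lower integral for nonnegative integrands), so
  `A · L³ = c²` for `A = L⁻³ (∫ Θ₀ ∫_cell Φ₀)²`;
* hence `Z(t)² = e^{-2Et}(e^{Et}Z(t))²`, `(A + ε) Z(2t) Z(0) = e^{-2Et} (c² + εL³) e^{2Et}Z(2t)`,
  and since `(e^{Et}Z(t))² → c⁴ < (c² + εL³)c² ← (c² + εL³) e^{2Et} Z(2t)`, the inequality
  `Z(t)² ≤ (A + ε) Z(2t) Z(0)` holds for all large `t`.

No spectral theorem and no gap lemma are used: the rank-one projection field encodes both.
-/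

noncomputable section

open MeasureTheory Filter Matrix
open scoped ENNReal NNReal BigOperators Topology

namespace Summit.AtomisticToContinuum.BoseEinsteinCondensation.Theorems.CorrectorClosure.ResidueAreaLaw

open Literature.MathematicalPhysics.QuantumManyBody.BoseGas

variable {N : ℕ}

/-! ### Tails and lattice translations -/

/-- Translating the inserted particle `0` does not move the tails. [folklore] -/
theorem fid_vecTail_add_single_zero (X : Config (N + 1)) (w : Space) :
    vecTail (X + Pi.single (0 : Fin (N + 1)) w) = vecTail X := by
  funext j
  simp only [Matrix.vecTail, Function.comp_apply, Pi.add_apply,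
    Pi.single_eq_of_ne (Fin.succ_ne_zero j), add_zero]

/-- Translating particle `i.succ` translates particle `i` of the tails. [folklore] -/
theorem fid_vecTail_add_single_succ (X : Config (N + 1)) (i : Fin N) (w : Space) :
    vecTail (X + Pi.single i.succ w) = vecTail X + Pi.single i w := by
  funext j
  simp only [Matrix.vecTail, Function.comp_apply, Pi.add_apply]
  congr 1
  by_cases h : j = i
  · subst h; simp
  · rw [Pi.single_eq_of_ne h, Pi.single_eq_of_ne (fun h' => h (Fin.succ_injective _ h'))]

/-- The flat datum `ofReal ∘ Θ₀ ∘ vecTail` is `Lℤ³`-periodic in every particle of `Config (N + 1)`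
when `Θ₀` is periodic in every particle of `Config N`. [folklore] -/
theorem fid_tail_periodic {L : ℝ} {Θ₀ : Config N → ℝ}
    (hper : ∀ (X : Config N) (i : Fin N) (k : Fin 3),
      Θ₀ (X + Pi.single i (EuclideanSpace.single k L)) = Θ₀ X)
    (X : Config (N + 1)) (i : Fin (N + 1)) (k : Fin 3) :
    ENNReal.ofReal (Θ₀ (vecTail (X + Pi.single i (EuclideanSpace.single k L)))) =
      ENNReal.ofReal (Θ₀ (vecTail X)) := by
  cases i using Fin.cases with
  | zero => rw [fid_vecTail_add_single_zero]
  | succ j => rw [fid_vecTail_add_single_succ, hper]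

/-! ### Bounds for continuous periodic functions -/

/-- A continuous, strictly positive function on configuration space that is `Lℤ³`-periodic in every
particle is bounded below by a positive constant (its minimum over the compact closed cell
`[0,L]^{3N}`, which contains the reduction `cellProj L X` of every `X`). [folklore] -/
theorem fid_exists_pos_le {L : ℝ} (hL : 0 < L) {Φ : Config N → ℝ} (hΦc : Continuous Φ)
    (hper : ∀ (X : Config N) (i : Fin N) (k : Fin 3),
      Φ (X + Pi.single i (EuclideanSpace.single k L)) = Φ X)
    (hpos : ∀ X, 0 < Φ X) : ∃ m : ℝ, 0 < m ∧ ∀ X, m ≤ Φ X := by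
  obtain ⟨hKc, hKsub⟩ := isCompact_closedCellN N L
  obtain ⟨X₀, -, hX₀⟩ := hKc.exists_isMinOn ⟨_, hKsub (cellProj_mem_cellN hL 0)⟩ hΦc.continuousOn
  refine ⟨Φ X₀, hpos X₀, fun X => ?_⟩
  rw [← apply_cellProj_of_periodic hper X]
  exact (isMinOn_iff.1 hX₀) _ (hKsub (cellProj_mem_cellN hL X))

/-! ### The renormalised functional of the flat datum is dominated by a constant -/

/-- Constants come out of the periodic Feynman–Kac functional:
`e^{-TH}(c g) = c · e^{-TH} g` for `c < ∞`. [folklore] -/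
theorem fid_periodicFKSemigroup_const_mul (v : ℝ → ℝ≥0∞) (L T : ℝ) {c : ℝ≥0∞} (hc : c ≠ ⊤)
    (g : Config N → ℝ≥0∞) (X : Config N) :
    periodicFKSemigroup v L T (fun Y => c * g Y) X = c * periodicFKSemigroup v L T g X := by
  unfold periodicFKSemigroup
  rw [← lintegral_const_mul' c _ hc]
  exact lintegral_congr fun ω => by ring

/-- **Domination of the renormalised functional.** If `g ≤ C · ofReal Φ₀` pointwise for a
Feynman–Kac ground state `Φ₀` and a finite constant `C`, then for `t ≥ 0` and every `X`,
`e^{E₀t}(e^{-tH} g)(X) ≤ C Φ₀(X)` (monotonicity and linearity of the functional, and the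
eigen-relation `e^{E₀t} e^{-tH} Φ₀ = Φ₀`). [folklore] -/
theorem fid_renorm_le {M : ℕ} {v : ℝ → ℝ≥0∞} {L : ℝ} {Φ₀ : Config M → ℝ}
    (hΦ : IsPeriodicGroundStateFK v L Φ₀) {g : Config M → ℝ≥0∞} {C : ℝ≥0∞} (hC : C ≠ ⊤)
    (hg : ∀ Y, g Y ≤ C * ENNReal.ofReal (Φ₀ Y)) {t : ℝ} (ht : 0 ≤ t) (X : Config M) :
    ENNReal.ofReal (Real.exp ((periodicGroundStateEnergy v M L).toReal * t)) *
        periodicFKSemigroup v L t g X ≤ C * ENNReal.ofReal (Φ₀ X) := by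
  calc ENNReal.ofReal (Real.exp ((periodicGroundStateEnergy v M L).toReal * t)) *
        periodicFKSemigroup v L t g X
      ≤ ENNReal.ofReal (Real.exp ((periodicGroundStateEnergy v M L).toReal * t)) *
          periodicFKSemigroup v L t (fun Y => C * ENNReal.ofReal (Φ₀ Y)) X :=
        mul_le_mul' le_rfl (periodicFKSemigroup_mono v L t (fun Y => hg Y) X)
    _ = C * (ENNReal.ofReal (Real.exp ((periodicGroundStateEnergy v M L).toReal * t)) *
          periodicFKSemigroup v L t (fun Y => ENNReal.ofReal (Φ₀ Y)) X) := by
        rw [fid_periodicFKSemigroup_const_mul v L t hC]; ring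
    _ = C * ENNReal.ofReal (Φ₀ X) := by rw [hΦ.ofReal_exp_mul_periodicFKSemigroup ht X]

/-! ### The overlap as a Bochner integral -/

/-- **The overlap `∫⁻_{cellN (N+1) L} ofReal Φ₀ · ofReal (Θ₀ ∘ vecTail)` is
`ofReal (∫_{cellN N L} Θ₀(X) ∫_{cell L} Φ₀(x, X) dx dX)`** for bounded measurable `Θ₀ ≥ 0` and
bounded continuous `Φ₀ ≥ 0` (Tonelli with the tagged coordinate innermost, then Bochner = lower
integral for the nonnegative integrable slices and for the bounded outer integrand). [folklore] -/
theorem fid_overlap_eq {L : ℝ} {Θ₀ : Config N → ℝ} {Φ₀ : Config (N + 1) → ℝ}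
    (hΘm : Measurable Θ₀) (hΘ0 : ∀ X, 0 ≤ Θ₀ X) {M : ℝ} (hM : ∀ X, |Θ₀ X| ≤ M)
    (hΦc : Continuous Φ₀) (hΦ0 : ∀ X, 0 ≤ Φ₀ X) {M' : ℝ} (hM' : ∀ X, |Φ₀ X| ≤ M') :
    ∫⁻ Y in cellN (N + 1) L, ENNReal.ofReal (Φ₀ Y) * ENNReal.ofReal (Θ₀ (vecTail Y)) =
      ENNReal.ofReal (∫ X in cellN N L, Θ₀ X * ∫ x in cell L, Φ₀ (vecCons x X)) := by
  have hΦm : Measurable Φ₀ := hΦc.measurable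
  have hmeas : Measurable fun Y : Config (N + 1) =>
      ENNReal.ofReal (Φ₀ Y) * ENNReal.ofReal (Θ₀ (vecTail Y)) :=
    hΦm.ennreal_ofReal.mul (hΘm.comp measurable_vecTail).ennreal_ofReal
  rw [setLIntegral_cellN_succ_right hmeas]
  simp only [Matrix.tail_cons]
  have hvol : volume (cell L) ≠ ⊤ := by
    rw [volume_cell]; exact ENNReal.pow_ne_top ENNReal.ofReal_ne_top
  -- the slices `x ↦ Φ₀ (x, X)` are continuous, bounded, hence integrable on the cell
  have hslc : ∀ X : Config N, Continuous fun x : Space => Φ₀ (vecCons x X) := fun X =>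
    hΦc.comp (continuous_id.matrixVecCons continuous_const)
  have hslice : ∀ X : Config N, Integrable (fun x => Φ₀ (vecCons x X)) (volume.restrict (cell L)) :=
    fun X => Measure.integrableOn_of_bounded (M := M') hvol (hslc X).measurable.aestronglyMeasurable
      (Eventually.of_forall fun x => by rw [Real.norm_eq_abs]; exact hM' _)
  have hinner : ∀ X : Config N,
      ∫⁻ x in cell L, ENNReal.ofReal (Φ₀ (vecCons x X)) * ENNReal.ofReal (Θ₀ X) =
        ENNReal.ofReal (Θ₀ X * ∫ x in cell L, Φ₀ (vecCons x X)) := by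
    intro X
    rw [lintegral_mul_const _ (hslc X).measurable.ennreal_ofReal,
      ← ofReal_integral_eq_lintegral_ofReal (hslice X) (Eventually.of_forall fun x => hΦ0 _),
      ← ENNReal.ofReal_mul' (hΘ0 X)]
    exact congrArg _ (mul_comm _ _)
  simp_rw [hinner]
  -- the outer integrand is measurable and bounded on the cell
  have hJm : Measurable fun X : Config N => ∫ x in cell L, Φ₀ (vecCons x X) := by
    have hsm : StronglyMeasurable
        (Function.uncurry fun (X : Config N) (x : Space) => Φ₀ (vecCons x X)) :=
      (hΦc.comp (continuous_snd.matrixVecCons continuous_fst)).measurable.stronglyMeasurable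
    exact (hsm.integral_prod_right (ν := volume.restrict (cell L))).measurable
  have hJb : ∀ X : Config N, |∫ x in cell L, Φ₀ (vecCons x X)| ≤ M' * volume.real (cell L) := by
    intro X
    rw [← Real.norm_eq_abs]
    exact norm_setIntegral_le_of_norm_le_const hvol.lt_top
      fun x _ => by rw [Real.norm_eq_abs]; exact hM' (vecCons x X)
  have hM0 : 0 ≤ M := (abs_nonneg _).trans (hM 0)
  have hprod : Integrable (fun X => Θ₀ X * ∫ x in cell L, Φ₀ (vecCons x X))
      (volume.restrict (cellN N L)) :=
    integrable_cellN_of_bound L (hΘm.mul hJm) (M := M * (M' * volume.real (cell L))) fun X => by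
      rw [abs_mul]
      exact mul_le_mul (hM X) (hJb X) (abs_nonneg _) hM0
  rw [← ofReal_integral_eq_lintegral_ofReal hprod (Eventually.of_forall fun X =>
    mul_nonneg (hΘ0 X) (setIntegral_nonneg (measurableSet_cell L) fun x _ => hΦ0 _))]


/-! ### The stub -/

/-- **Stub 4 of line `residue-area-law` — the fidelity limit: `1/D(t) → A` (fixed `N`, `L > 0`;
every measurable `v` once both FK ground states are given).** With `Θ₀` the `N`-body and `Φ₀` the
`(N+1)`-body torus FK ground states (`Φ₀` continuous and positive) and
`A = L⁻³(∫_{cell^N} Θ₀(X) ∫_cell Φ₀(x, X) dx dX)²` (the insertion residue of the TRUE ground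
states), for every `ε > 0` there is `T₁` with `𝒵(t)² ≤ (A + ε)·𝒵(2t)·𝒵(0)` for all `t ≥ T₁`.
Proof: with `g = ofReal ∘ Θ₀ ∘ vecTail` (measurable, periodic, `∫_cell g² = L³`), the projection
field `hΦ.tendsto g` gives `e^{E₀t}(e^{-tH} g)(X) → c·Φ₀(X)`, `c = ∫⁻_cell ofReal Φ₀ · g`; the
domination `e^{E₀t}(e^{-tH} g) ≤ (M/m)Φ₀ ≤ (M/m)M'` (`Θ₀ ≤ M`, `Φ₀ ≥ m > 0`, `Φ₀ ≤ M'`) and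
dominated convergence on the finite-measure cell give `e^{E₀t}𝒵(t) → c²`, `e^{2E₀t}𝒵(2t) → c²` with
`0 < c < ∞`; `𝒵(0) = L³` (`stub_flatDomination`) and `c = ofReal (∫ Θ₀ ∫_cell Φ₀)` turn
`(A + ε)𝒵(2t)𝒵(0)` into `e^{-2E₀t}(c² + εL³)e^{2E₀t}𝒵(2t)`, and `c⁴ < (c² + εL³)c²` makes the
inequality eventual. [folklore] -/
theorem stub_fidelityLimit (v : ℝ → ℝ≥0∞) (hv : Measurable v) (N : ℕ) (L : ℝ) (hL : 0 < L)
    (Θ₀ : Config N → ℝ) (hΘ : IsPeriodicGroundStateFK v L Θ₀) (hΘc : Continuous Θ₀)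
    (Φ₀ : Config (N + 1) → ℝ) (hΦ : IsPeriodicGroundStateFK v L Φ₀) (hΦc : Continuous Φ₀)
    (hΦp : ∀ X, 0 < Φ₀ X) (Z : ℝ → ℝ≥0∞)
    (hZ : Z = fun t => ∫⁻ X in cellN (N + 1) L, ENNReal.ofReal (Θ₀ (vecTail X)) *
      periodicFKSemigroup v L t (fun Y => ENNReal.ofReal (Θ₀ (vecTail Y))) X)
    (ε : ℝ) (hε : 0 < ε) :
    ∃ T₁ : ℝ, ∀ t : ℝ, T₁ ≤ t →
      Z t ^ 2 ≤
        (ENNReal.ofReal ((L ^ 3)⁻¹ *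
            (∫ X in cellN N L, Θ₀ X * ∫ x in cell L, Φ₀ (vecCons x X)) ^ 2) +
          ENNReal.ofReal ε) * (Z (2 * t) * Z 0) := by
  -- `Z 0 = L³`
  have hZ0 : Z 0 = ENNReal.ofReal (L ^ 3) := (stub_flatDomination v hv N L hL Θ₀ hΘ Z hZ).1
  -- notation: the flat datum `g`, the energy `E`, the overlap `c`, the residue integral `I`
  obtain ⟨g, hg⟩ : ∃ g : Config (N + 1) → ℝ≥0∞, g = fun Y => ENNReal.ofReal (Θ₀ (vecTail Y)) :=
    ⟨_, rfl⟩
  obtain ⟨E, hE⟩ : ∃ E : ℝ, E = (periodicGroundStateEnergy v (N + 1) L).toReal := ⟨_, rfl⟩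
  obtain ⟨c, hc⟩ : ∃ c : ℝ≥0∞, c = ∫⁻ Y in cellN (N + 1) L, ENNReal.ofReal (Φ₀ Y) * g Y :=
    ⟨_, rfl⟩
  set I : ℝ := ∫ X in cellN N L, Θ₀ X * ∫ x in cell L, Φ₀ (vecCons x X) with hI
  have hZt : ∀ t, Z t = ∫⁻ X in cellN (N + 1) L, g X * periodicFKSemigroup v L t g X := by
    intro t; rw [hZ, hg]
  -- measurability, periodicity and the cell mass of `g`
  have hΘm : Measurable fun Y : Config N => ENNReal.ofReal (Θ₀ Y) :=
    ENNReal.measurable_ofReal.comp hΘ.measurable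
  have hgm : Measurable g := by rw [hg]; exact hΘm.comp measurable_vecTail
  have hgper : ∀ (X : Config (N + 1)) (i : Fin (N + 1)) (k : Fin 3),
      g (X + Pi.single i (EuclideanSpace.single k L)) = g X := by
    intro X i k; rw [hg]; exact fid_tail_periodic hΘ.periodic X i k
  have hg2 : ∫⁻ Y in cellN (N + 1) L, g Y ^ 2 = ENNReal.ofReal (L ^ 3) := by
    have h := flatDom_setLIntegral_tail_mul hL hΘ 1
    rw [one_mul] at h
    rw [← h, hg]
    exact lintegral_congr fun Y => by rw [sq, one_mul]
  have hL3 : 0 < L ^ 3 := by positivity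
  have hg2' : ∫⁻ Y in cellN (N + 1) L, g Y ^ 2 ≠ ⊤ := by rw [hg2]; exact ENNReal.ofReal_ne_top
  -- bounds: `Θ₀ ≤ M`, `Φ₀ ≤ M'`, `Φ₀ ≥ m > 0`
  obtain ⟨M, hM0, hM⟩ := exists_bound_of_continuous_periodic hL hΘc hΘ.periodic
  obtain ⟨M', -, hM'⟩ := exists_bound_of_continuous_periodic hL hΦc hΦ.periodic
  obtain ⟨m, hm, hmle⟩ := fid_exists_pos_le hL hΦc hΦ.periodic hΦp
  have hgM : ∀ Y, g Y ≤ ENNReal.ofReal M := fun Y => by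
    rw [hg]; exact ENNReal.ofReal_le_ofReal ((le_abs_self _).trans (hM _))
  have hΦM' : ∀ Y, ENNReal.ofReal (Φ₀ Y) ≤ ENNReal.ofReal M' := fun Y =>
    ENNReal.ofReal_le_ofReal ((le_abs_self _).trans (hM' _))
  have hgC : ∀ Y, g Y ≤ ENNReal.ofReal (M / m) * ENNReal.ofReal (Φ₀ Y) := by
    intro Y
    rw [hg, ← ENNReal.ofReal_mul (by positivity)]
    refine ENNReal.ofReal_le_ofReal ?_
    calc Θ₀ (vecTail Y) ≤ M := (le_abs_self _).trans (hM _)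
      _ = M / m * m := by field_simp
      _ ≤ M / m * Φ₀ Y := mul_le_mul_of_nonneg_left (hmle Y) (by positivity)
  -- domination of the renormalised functional, `t ≥ 0`
  have hu : ∀ t : ℝ, 0 ≤ t → ∀ X,
      ENNReal.ofReal (Real.exp (E * t)) * periodicFKSemigroup v L t g X ≤
        ENNReal.ofReal (M / m) * ENNReal.ofReal M' := by
    intro t ht X
    rw [hE]
    exact (fid_renorm_le hΦ ENNReal.ofReal_ne_top hgC ht X).trans (mul_le_mul' le_rfl (hΦM' X))
  -- the overlap is finite and nonzero
  have hc_top : c ≠ ⊤ := by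
    rw [hc]
    refine ne_top_of_le_ne_top ?_
      (lintegral_mono (g := fun _ => ENNReal.ofReal M' * ENNReal.ofReal M)
        fun Y => mul_le_mul' (hΦM' Y) (hgM Y))
    rw [setLIntegral_const]
    exact ENNReal.mul_ne_top (ENNReal.mul_ne_top ENNReal.ofReal_ne_top ENNReal.ofReal_ne_top)
      (volume_cellN_ne_top _ _)
  have hc_pos : c ≠ 0 := by
    have hgi : ∫⁻ Y in cellN (N + 1) L, g Y ≠ 0 := by
      intro h0
      have hae := (lintegral_eq_zero_iff hgm).1 h0
      have h2 : ∫⁻ Y in cellN (N + 1) L, g Y ^ 2 = 0 := by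
        refine (lintegral_eq_zero_iff (hgm.pow_const 2)).2 ?_
        filter_upwards [hae] with Y hY
        simp only [Pi.zero_apply] at hY
        simp only [hY, Pi.zero_apply, ne_eq, OfNat.ofNat_ne_zero, not_false_eq_true, zero_pow]
      rw [hg2] at h2
      exact absurd h2 (ENNReal.ofReal_pos.2 hL3).ne'
    have hle : ENNReal.ofReal m * ∫⁻ Y in cellN (N + 1) L, g Y ≤ c := by
      rw [hc, ← lintegral_const_mul _ hgm]
      exact lintegral_mono fun Y => mul_le_mul' (ENNReal.ofReal_le_ofReal (hmle Y)) le_rfl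
    intro h0
    rw [h0, nonpos_iff_eq_zero] at hle
    exact mul_ne_zero (ENNReal.ofReal_pos.2 hm).ne' hgi hle
  -- the limit `e^{Et} Z(t) → c²` by dominated convergence
  have hU : Tendsto (fun t : ℝ => ENNReal.ofReal (Real.exp (E * t)) * Z t) atTop (𝓝 (c * c)) := by
    have hF : ∀ t, ENNReal.ofReal (Real.exp (E * t)) * Z t = ∫⁻ X in cellN (N + 1) L,
        g X * (ENNReal.ofReal (Real.exp (E * t)) * periodicFKSemigroup v L t g X) := by
      intro t
      rw [hZt, ← lintegral_const_mul' _ _ ENNReal.ofReal_ne_top]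
      exact lintegral_congr fun X => by ring
    have hlim : ∫⁻ X in cellN (N + 1) L, g X * (c * ENNReal.ofReal (Φ₀ X)) = c * c :=
      calc ∫⁻ X in cellN (N + 1) L, g X * (c * ENNReal.ofReal (Φ₀ X))
          = ∫⁻ X in cellN (N + 1) L, c * (ENNReal.ofReal (Φ₀ X) * g X) :=
            lintegral_congr fun X => by ring
        _ = c * ∫⁻ X in cellN (N + 1) L, ENNReal.ofReal (Φ₀ X) * g X :=
            lintegral_const_mul' _ _ hc_top
        _ = c * c := by rw [← hc]
    simp_rw [hF]
    rw [← hlim]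
    refine tendsto_lintegral_filter_of_dominated_convergence
      (fun _ => ENNReal.ofReal M * (ENNReal.ofReal (M / m) * ENNReal.ofReal M')) ?_ ?_ ?_ ?_
    · exact Eventually.of_forall fun t =>
        hgm.mul ((measurable_periodicFKSemigroup hv L t hgm).const_mul _)
    · filter_upwards [eventually_ge_atTop (0 : ℝ)] with t ht
      exact Eventually.of_forall fun X => mul_le_mul' (hgM X) (hu t ht X)
    · rw [setLIntegral_const]
      exact ENNReal.mul_ne_top (ENNReal.mul_ne_top ENNReal.ofReal_ne_top
        (ENNReal.mul_ne_top ENNReal.ofReal_ne_top ENNReal.ofReal_ne_top)) (volume_cellN_ne_top _ _)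
    · refine Eventually.of_forall fun X => ?_
      have h := hΦ.tendsto g hgm hgper hg2' X
      rw [← hE, ← hc] at h
      exact ENNReal.Tendsto.const_mul h (Or.inr ((hgM X).trans_lt ENNReal.ofReal_lt_top).ne)
  -- the same limit along `2t`
  have hW : Tendsto (fun t : ℝ => ENNReal.ofReal (Real.exp (E * (2 * t))) * Z (2 * t)) atTop
      (𝓝 (c * c)) :=
    hU.comp (tendsto_id.const_mul_atTop (two_pos : (0 : ℝ) < 2))
  -- the strict inequality of the limits and its eventual version
  have hδ0 : ENNReal.ofReal (ε * L ^ 3) ≠ 0 := (ENNReal.ofReal_pos.2 (by positivity)).ne'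
  have hcc0 : c * c ≠ 0 := mul_ne_zero hc_pos hc_pos
  have hcct : c * c ≠ ⊤ := ENNReal.mul_ne_top hc_top hc_top
  have hlt : (c * c) ^ 2 < (c * c + ENNReal.ofReal (ε * L ^ 3)) * (c * c) := by
    rw [sq]
    exact ENNReal.mul_lt_mul_left hcc0 hcct (ENNReal.lt_add_right hcct hδ0)
  have hU2 : Tendsto (fun t : ℝ => (ENNReal.ofReal (Real.exp (E * t)) * Z t) ^ 2) atTop
      (𝓝 ((c * c) ^ 2)) := ENNReal.Tendsto.pow hU
  have hW2 : Tendsto (fun t : ℝ => (c * c + ENNReal.ofReal (ε * L ^ 3)) *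
      (ENNReal.ofReal (Real.exp (E * (2 * t))) * Z (2 * t))) atTop
      (𝓝 ((c * c + ENNReal.ofReal (ε * L ^ 3)) * (c * c))) :=
    ENNReal.Tendsto.const_mul hW (Or.inr (ENNReal.add_ne_top.2 ⟨hcct, ENNReal.ofReal_ne_top⟩))
  obtain ⟨T₁, hT₁⟩ := Filter.eventually_atTop.1 (hU2.eventually_lt hW2 hlt)
  -- the key identity `c = ofReal I` and `(A + ε) L³ = c² + εL³`
  have hI0 : 0 ≤ I := setIntegral_nonneg (measurableSet_cellN N L) fun X _ =>
    mul_nonneg (hΘ.nonneg X) (setIntegral_nonneg (measurableSet_cell L) fun x _ => hΦ.nonneg _)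
  have hcI : c = ENNReal.ofReal I := by
    rw [hI, hc, hg]
    exact fid_overlap_eq hΘ.measurable hΘ.nonneg hM hΦc hΦ.nonneg hM'
  have hA : (ENNReal.ofReal ((L ^ 3)⁻¹ * I ^ 2) + ENNReal.ofReal ε) * ENNReal.ofReal (L ^ 3) =
      c * c + ENNReal.ofReal (ε * L ^ 3) := by
    rw [add_mul, ← ENNReal.ofReal_mul (by positivity), ← ENNReal.ofReal_mul hε.le, hcI,
      ← ENNReal.ofReal_mul hI0, inv_mul_eq_div, div_mul_cancel₀ _ hL3.ne', sq]
  refine ⟨T₁, fun t ht => ?_⟩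
  have hlt_t := hT₁ t ht
  -- exponential bookkeeping
  have hreal : Real.exp (E * t) ^ 2 = Real.exp (E * (2 * t)) := by
    rw [sq, ← Real.exp_add]; congr 1; ring
  have hd1 : ENNReal.ofReal (Real.exp (-(E * (2 * t)))) *
      ENNReal.ofReal (Real.exp (E * t)) ^ 2 = 1 := by
    rw [← ENNReal.ofReal_pow (Real.exp_pos _).le, hreal, ← ENNReal.ofReal_mul (Real.exp_pos _).le,
      ← Real.exp_add, neg_add_cancel, Real.exp_zero, ENNReal.ofReal_one]
  have hd2 : ENNReal.ofReal (Real.exp (-(E * (2 * t)))) *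
      ENNReal.ofReal (Real.exp (E * (2 * t))) = 1 := by
    rw [← ENNReal.ofReal_mul (Real.exp_pos _).le, ← Real.exp_add, neg_add_cancel, Real.exp_zero,
      ENNReal.ofReal_one]
  calc Z t ^ 2 = ENNReal.ofReal (Real.exp (-(E * (2 * t)))) *
        ENNReal.ofReal (Real.exp (E * t)) ^ 2 * Z t ^ 2 := by rw [hd1, one_mul]
    _ = ENNReal.ofReal (Real.exp (-(E * (2 * t)))) *
        (ENNReal.ofReal (Real.exp (E * t)) * Z t) ^ 2 := by ring
    _ ≤ ENNReal.ofReal (Real.exp (-(E * (2 * t)))) * ((c * c + ENNReal.ofReal (ε * L ^ 3)) *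
          (ENNReal.ofReal (Real.exp (E * (2 * t))) * Z (2 * t))) := mul_le_mul' le_rfl hlt_t.le
    _ = (c * c + ENNReal.ofReal (ε * L ^ 3)) * (ENNReal.ofReal (Real.exp (-(E * (2 * t)))) *
          ENNReal.ofReal (Real.exp (E * (2 * t)))) * Z (2 * t) := by ring
    _ = (ENNReal.ofReal ((L ^ 3)⁻¹ * I ^ 2) + ENNReal.ofReal ε) * ENNReal.ofReal (L ^ 3) *
          Z (2 * t) := by rw [hd2, mul_one, hA]
    _ = (ENNReal.ofReal ((L ^ 3)⁻¹ * I ^ 2) + ENNReal.ofReal ε) * (Z (2 * t) * Z 0) := by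
        rw [hZ0]; ring

end Summit.AtomisticToContinuum.BoseEinsteinCondensation.Theorems.CorrectorClosure.ResidueAreaLaw

end
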